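/-
Copyright (c) 2026 the pub-hodgecm-mathlib formalisation cell (harness21).  Prover seat hodgecm-mathlib-K2E3-p23 (g7), HCML Track B «K2-LIT»,
h413 = `stmt-HodgeConjecture-24833`, line `K2_E3_EllipticInputs`, unit U12 «Characters», PART «SC» (ED. 2) leaf (SC-an)₂ `sig_K2E3SupercuspidalTruncatedCharAnalyticTwo`,
road «FC₂» — THE CLOSING ASSEMBLY: (SC-an)₂ from every ★ letter payer BY NAME, modulo the ONE remaining letter (LIM₂).  2026-09-04.
-/
import Summits.HodgeConjecture.HodgeConjecture.Theorems.K2E3SupercuspidalTruncatedCharAnalyticTwoOfLetters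
import Summits.HodgeConjecture.HodgeConjecture.Theorems.K2E3SupercuspidalTruncatedCharAnalyticTwoOfEllWeight
import Summits.HodgeConjecture.HodgeConjecture.Theorems.K2E3FinConjCartanCoverTwo
import Summits.HodgeConjecture.HodgeConjecture.Theorems.K2E3BoxCompactCentralizerCollisionTwo
import Summits.HodgeConjecture.HodgeConjecture.Theorems.K2E3TorusNearCollisionBoundTwo
import Summits.HodgeConjecture.HodgeConjecture.Theorems.K2E3SupercuspidalTruncatedCharTorusDepthLettersTwo
import Summits.HodgeConjecture.HodgeConjecture.Theorems.K2E3SupercuspidalTruncatedCharWeightKitShellTwo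
import Summits.HodgeConjecture.HodgeConjecture.Theorems.K2E3SupercuspidalTruncatedCharTokenLocIntLetterTwo
import HarnessLib

/-!
# h413 ∕ Track B «K2-LIT», unit U12, PART «SC» leaf (SC-an)₂, road «FC₂» — **(SC-an)₂ MODULO EXACTLY ONE NAMED LETTER (LIM₂)**: Harish-Chandra's two estimates
# on the truncated orbital integrals of a supercuspidal coefficient of `U(Φ₂)(L⁺_v)`, `v` non-split, from the explicit limit ∕ localisation ∕ height-ball reduction
# (LIM₂ = the `Fin 2` twin of ★ [M2c′] `explicit_limit_localisation_and_hball_reduction`, in flight: K2E1-p10 (g3) D144-2) and NOTHING ELSE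
# (Harish-Chandra 1970, Part VII §3 Theorem 16 and its proof for `U(1,1)`)

Cell `pub/hodgecm-mathlib`, crux H413 = `stmt-HodgeConjecture-24833`, route of record `HCCMUnconditional`; chair K2-lead (g2), L4 LINE-LEAD ∕ dealer K2E3-plan (g4), architect
K2E3-p25 (g3).  THEOREMS ONLY (no `def`, no `instance`, no `notation`, no named-fact hypothesis, no `sorry`); lane `--supports stmt-HodgeConjecture-24833 --as helper`, count-neutral.

THE ASSEMBLY.  ★ `K2E3SupercuspidalTruncatedCharAnalyticTwoOfLetters.sigSCanTwo_of_letters (hCOV hUP hDIAG hCOLL hNC) (hM5h₂)` (this seat, FC₂-8 §B) with EVERY letter discharged BY NAME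
on ★ heads of the L4 wave 2026-09-04T14:52–15:30Z: (F1₂-COVER)∕(F1₂-UPPER)∕(F2₂) := ★ p861071 `K2E3FinConjCartanCoverTwo.exists_mem_doubleCoset_inv_pow` ∕ `v_upper_le_of_conj_inv_pow` ∕
`exp_neg_le_v_apply_diag` (K2E3-p26 (g0); `fun`-adapters: idle binders dropped, `M < n ⇒ exp(−M)` weakened to `3M < n ⇒ exp(−2M)` by `WithZero.exp_le_exp`); (FC-6₂) := ★ p861203
`K2E3BoxCompactCentralizerCollisionTwo.exists_v_sub_lt_of_isCompact_centralizer` (K2E3-p26 (g0); the idle `[CharZero K]` of the letter dropped by η-expansion); (FC-5c₂) := ★ p861142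
`K2E3TorusNearCollisionBoundTwo.measure_inter_nearCollision_le_two` (K2E3-p28 (g0), byte-exact); (M5h)₂ := ★ p861288 `K2E3SupercuspidalTruncatedCharAnalyticTwoOfEllWeight.sigSCanTwo_of_ellWeightPlace_two`
(this seat) fed with (SHELL₂) ★ p861358 `K2E3SupercuspidalTruncatedCharWeightKitShellTwo.exists_const_integral_heightBall_norm_conj_le_shell_place` (K2E3-p33 (g0)), (TOK₂) ★ p861307
`K2E3SupercuspidalTruncatedCharTokenLocIntLetterTwo.tokenLocInt_letter` (K2E3-p29 (g0)), (TORΩ₂)∕(DEPTH₂) ★ p861268 `K2E3SupercuspidalTruncatedCharTorusDepthLettersTwo.torusOmega_letter` ∕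
`depth_letter` (K2E3-p33 (g0)) — all byte-exact — and the ONE remaining binder **(LIM₂) `hLIM`** (the `Fin 2` twin of ★ `K2E3SupercuspidalTruncatedCharLimCancExplicit.explicit_limit_localisation_and_hball_reduction`,
∀-closed, radius clause frozen at N = 3's; payer K2E1-p10 (g3) `…LimCancExplicitTwo`, D144-2).
* **`sigSCanTwo_of_lim (hLIM) : ‹(SC-an)₂ PART «SC» ED. 2 :98 VERBATIM›`** — THE TIE SHAPE: `sig_K2E3SupercuspidalTruncatedCharAnalyticTwo := K2E3SupercuspidalTruncatedCharAnalyticTwoOfLim.sigSCanTwo_of_lim ‹LIM₂ socket ∕ ★ name›`.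

HONEST LABEL.  HC_CM is proved only modulo the 7 printed citations (2 remaining named inputs: hLiu418 = `stmt-HodgeConjecture-24832`, h413 = `stmt-HodgeConjecture-24833`)
until rung 0 closes; count-neutral; (SC-an)₂ becomes REL over EXACTLY {LIM₂} when tied through this file — NOT ★ until LIM₂ lands.

## References
* [HarishChandra1970] Harish-Chandra (notes by G. van Dijk), *Harmonic Analysis on Reductive p-adic Groups*, LNM 162 (1970), Part VII §3 Thm. 16 p. 67, pp. 70–73; Thms 14–15, 18–20.
* [HarishChandra1999] Harish-Chandra (notes by S. DeBacker, P. J. Sally Jr.), *Admissible Invariant Distributions on Reductive p-adic Groups*, AMS ULS 16 (1999), Thm. 16.1 p. 77.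
* [Rogawski1990] J. D. Rogawski, *Automorphic Representations of Unitary Groups in Three Variables*, Ann. of Math. Stud. 123 (1990), §1.9–§1.10 pp. 8–9, §12.2 p. 173.
-/

set_option autoImplicit false
-- the mandated namespace repeats the single-problem summit's segment (`HodgeConjecture.HodgeConjecture`)
set_option linter.dupNamespace false

noncomputable section

open MeasureTheory Measure Set Filter Topology NumberField IsDedekindDomain
open scoped NNReal ENNReal Pointwise Matrix MatrixGroups WithZero Valued
open ValuativeRel
open Literature.NumberTheory.Automorphic Literature.NumberTheory.Automorphic.UnitaryGroup Literature.NumberTheory.Automorphic.HermitianLattice Literature.NumberTheory.Rogawski1990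
open Literature.NumberTheory.GaloisRepresentations Literature.NumberTheory.GaloisRepresentations.IsNonarchimedeanLocalField

namespace Summit.HodgeConjecture.HodgeConjecture.Cruxes.H413.K2E3SupercuspidalTruncatedCharAnalyticTwoOfLim

set_option maxHeartbeats 3200000 in -- long statement (the ∀-closed LIM₂ letter + the (SC-an)₂ socket text) and the by-name assembly
set_option synthInstance.maxHeartbeats 400000 in
open scoped Classical in
/-- **(SC-an)₂ MODULO (LIM₂) ONLY** — Harish-Chandra's (SC-lim∖ell) ∧ (SC-dom) for the supercuspidal `SmoothIrrep`s of `U(Φ₂)(L⁺_v)` (`v` non-split), = PART «SC» ED. 2 :98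
`sig_K2E3SupercuspidalTruncatedCharAnalyticTwo` VERBATIM, from the explicit limit ∕ localisation ∕ height-ball reduction letter (LIM₂) alone: ★ `sigSCanTwo_of_letters` with the five FC₂
letters and the (M5h)₂ engine discharged BY NAME on ★ p861071 ∕ p861203 ∕ p861142 ∕ p861288 (∘ ★ p861358 ∕ p861307 ∕ p861268).  TIE: `sig_K2E3SupercuspidalTruncatedCharAnalyticTwo :=
sigSCanTwo_of_lim ‹LIM₂›`. [cite: HarishChandra1970, Part VII §3 Thm. 16 p. 67, pp. 70–73; Thms 14–15, 18–20] [cite: HarishChandra1999, Thm. 16.1 p. 77] [cite: Rogawski1990, §12.2 p. 173] -/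
theorem sigSCanTwo_of_lim
    (hLIM : ∀ (L : Type) [Field L] [NumberField L] [IsCMField L] {v : HeightOneSpectrum (𝓞 ↥(maximalRealSubfield L))} (w : PlacesOver L v) (hw : IsCMField.complexConj L • w.1 = w.1)
          [MeasurableSpace ((UnitaryGroup.cmDatum L 2 (Matrix.of fun i j : Fin 2 => if i.val + j.val + 1 = 2 then (1 : L) else 0)).Local v)] [BorelSpace ((UnitaryGroup.cmDatum L 2 (Matrix.of fun i j : Fin 2 => if i.val + j.val + 1 = 2 then (1 : L) else 0)).Local v)]
          (μ : Measure ((UnitaryGroup.cmDatum L 2 (Matrix.of fun i j : Fin 2 => if i.val + j.val + 1 = 2 then (1 : L) else 0)).Local v)) [μ.IsHaarMeasure]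
          [MeasurableSpace ↥(unitaryGroupOfForm (galAdicCompletionMap (L := L) (IsCMField.complexConj L) hw) ((StdForm.antidiagonal 2).over (w.1.adicCompletion L)))]
          [BorelSpace ↥(unitaryGroupOfForm (galAdicCompletionMap (L := L) (IsCMField.complexConj L) hw) ((StdForm.antidiagonal 2).over (w.1.adicCompletion L)))]
          (e : (UnitaryGroup.cmDatum L 2 (Matrix.of fun i j : Fin 2 => if i.val + j.val + 1 = 2 then (1 : L) else 0)).Local v ≃ₜ*
            ↥(unitaryGroupOfForm (galAdicCompletionMap (L := L) (IsCMField.complexConj L) hw) ((StdForm.antidiagonal 2).over (w.1.adicCompletion L))))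
          (ΩM : CompactExhaustion ↥(unitaryGroupOfForm (galAdicCompletionMap (L := L) (IsCMField.complexConj L) hw) ((StdForm.antidiagonal 2).over (w.1.adicCompletion L))))
          {ϖ : w.1.adicCompletion L} (hϖ : Valued.v ϖ = WithZero.exp (-1 : ℤ))
          (hmem : ∀ (m : ℕ) (g : ↥(unitaryGroupOfForm (galAdicCompletionMap (L := L) (IsCMField.complexConj L) hw) ((StdForm.antidiagonal 2).over (w.1.adicCompletion L)))), g ∈ ΩM m ↔
            (∀ i j, Valued.v (ϖ ^ m * ((g : GL (Fin 2) (w.1.adicCompletion L)) : Matrix (Fin 2) (Fin 2) (w.1.adicCompletion L)) i j) ≤ 1) ∧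
              ∀ i j, Valued.v (ϖ ^ m * (((g : GL (Fin 2) (w.1.adicCompletion L))⁻¹ : GL (Fin 2) (w.1.adicCompletion L)) : Matrix (Fin 2) (Fin 2) (w.1.adicCompletion L)) i j) ≤ 1)
          (hinv : ∀ (m : ℕ) (g : ↥(unitaryGroupOfForm (galAdicCompletionMap (L := L) (IsCMField.complexConj L) hw) ((StdForm.antidiagonal 2).over (w.1.adicCompletion L)))), g ∈ ΩM m → g⁻¹ ∈ ΩM m)
          (hmul : ∀ (a b : ℕ) (g h : ↥(unitaryGroupOfForm (galAdicCompletionMap (L := L) (IsCMField.complexConj L) hw) ((StdForm.antidiagonal 2).over (w.1.adicCompletion L)))),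
            g ∈ ΩM a → h ∈ ΩM b → g * h ∈ ΩM (a + b))
          {V : Type} [AddCommGroup V] [Module ℂ V] (ρ : Representation ℂ ((UnitaryGroup.cmDatum L 2 (Matrix.of fun i j : Fin 2 => if i.val + j.val + 1 = 2 then (1 : L) else 0)).Local v) V) (hsm : ρ.IsSmooth) (hsc : ρ.IsSupercuspidal)
          (B : V →ₗ⋆[ℂ] V →ₗ[ℂ] ℂ) (hBinv : ∀ (g : (UnitaryGroup.cmDatum L 2 (Matrix.of fun i j : Fin 2 => if i.val + j.val + 1 = 2 then (1 : L) else 0)).Local v) (x y : V), B (ρ g x) (ρ g y) = B x y) (u u' : V),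
          ∃ (Ω : CompactExhaustion ((UnitaryGroup.cmDatum L 2 (Matrix.of fun i j : Fin 2 => if i.val + j.val + 1 = 2 then (1 : L) else 0)).Local v)) (R : (UnitaryGroup.cmDatum L 2 (Matrix.of fun i j : Fin 2 => if i.val + j.val + 1 = 2 then (1 : L) else 0)).Local v → ℕ) (mθ : ℕ)
            (F : (UnitaryGroup.cmDatum L 2 (Matrix.of fun i j : Fin 2 => if i.val + j.val + 1 = 2 then (1 : L) else 0)).Local v → ℂ) (Bset : (UnitaryGroup.cmDatum L 2 (Matrix.of fun i j : Fin 2 => if i.val + j.val + 1 = 2 then (1 : L) else 0)).Local v → Set ((UnitaryGroup.cmDatum L 2 (Matrix.of fun i j : Fin 2 => if i.val + j.val + 1 = 2 then (1 : L) else 0)).Local v)),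
            (∀ n : ℕ, (Ω n : Set ((UnitaryGroup.cmDatum L 2 (Matrix.of fun i j : Fin 2 => if i.val + j.val + 1 = 2 then (1 : L) else 0)).Local v)) = e ⁻¹' (ΩM n)) ∧
            (∀ g, Bset g = e ⁻¹' (ΩM (R g))) ∧ (∀ g, IsCompact (Bset g)) ∧ (∀ᵐ g ∂μ, ¬ (IsRegularElt (g.val : GL (Fin 2) (UnitaryGroup.LocalRing L v)) ∧
                IsCompact ((Subgroup.centralizer ({g} : Set ((UnitaryGroup.cmDatum L 2 (Matrix.of fun i j : Fin 2 => if i.val + j.val + 1 = 2 then (1 : L) else 0)).Local v))) : Set ((UnitaryGroup.cmDatum L 2 (Matrix.of fun i j : Fin 2 => if i.val + j.val + 1 = 2 then (1 : L) else 0)).Local v))) →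
              Tendsto (fun n => ∫ x in Ω n, B u' (ρ (x * g * x⁻¹) u) ∂μ) atTop (𝓝 (F g))) ∧ (∀ n : ℕ, ∀ᵐ g ∂μ, ¬ (IsRegularElt (g.val : GL (Fin 2) (UnitaryGroup.LocalRing L v)) ∧
                IsCompact ((Subgroup.centralizer ({g} : Set ((UnitaryGroup.cmDatum L 2 (Matrix.of fun i j : Fin 2 => if i.val + j.val + 1 = 2 then (1 : L) else 0)).Local v))) : Set ((UnitaryGroup.cmDatum L 2 (Matrix.of fun i j : Fin 2 => if i.val + j.val + 1 = 2 then (1 : L) else 0)).Local v))) →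
              ∫ x in Ω n, B u' (ρ (x * g * x⁻¹) u) ∂μ = ∫ x in Ω n ∩ Bset g, B u' (ρ (x * g * x⁻¹) u) ∂μ) ∧
            (∀ m' : ↥(unitaryGroupOfForm (galAdicCompletionMap (L := L) (IsCMField.complexConj L) hw) ((StdForm.antidiagonal 2).over (w.1.adicCompletion L))),
              B u' (ρ (e.symm m') u) ≠ 0 → m' ∈ ΩM mθ) ∧
            (∀ g : (UnitaryGroup.cmDatum L 2 (Matrix.of fun i j : Fin 2 => if i.val + j.val + 1 = 2 then (1 : L) else 0)).Local v, IsRegularElt ((e g : ↥(unitaryGroupOfForm (galAdicCompletionMap (L := L) (IsCMField.complexConj L) hw)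
                ((StdForm.antidiagonal 2).over (w.1.adicCompletion L)))) : GL (Fin 2) (w.1.adicCompletion L)) →
              ¬ IsCompact ((Subgroup.centralizer ({g} : Set ((UnitaryGroup.cmDatum L 2 (Matrix.of fun i j : Fin 2 => if i.val + j.val + 1 = 2 then (1 : L) else 0)).Local v))) : Set ((UnitaryGroup.cmDatum L 2 (Matrix.of fun i j : Fin 2 => if i.val + j.val + 1 = 2 then (1 : L) else 0)).Local v)) →
              ∃ (t y₀ : ↥(unitaryGroupOfForm (galAdicCompletionMap (L := L) (IsCMField.complexConj L) hw) ((StdForm.antidiagonal 2).over (w.1.adicCompletion L))))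
                (d : Fin 2 → (w.1.adicCompletion L)ˣ) (lam mg : ℕ),
                glDiagonal 2 (w.1.adicCompletion L) d = (t : GL (Fin 2) (w.1.adicCompletion L)) ∧ IsRegularElt (t : GL (Fin 2) (w.1.adicCompletion L)) ∧
                (∀ i k : Fin 2, i ≠ k → Valued.v (ϖ ^ lam) ≤ Valued.v ((d i : w.1.adicCompletion L) - d k)) ∧
                (∀ lam' : ℕ, (∀ i k : Fin 2, i ≠ k → Valued.v (ϖ ^ lam') ≤ Valued.v ((d i : w.1.adicCompletion L) - d k)) → lam ≤ lam') ∧ e g ∈ ΩM mg ∧ (∀ m' : ℕ, e g ∈ ΩM m' → mg ≤ m') ∧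
                y₀ ∈ ΩM (2 * mg + 2 * lam) ∧ e g = y₀ * t * y₀⁻¹ ∧ R g = 5 * (2 * mθ + 2 * lam) + 3 * (2 * mg + 2 * lam) + 1) ∧
            (∀ᵐ g ∂μ, IsRegularElt ((e g : ↥(unitaryGroupOfForm (galAdicCompletionMap (L := L) (IsCMField.complexConj L) hw)
                ((StdForm.antidiagonal 2).over (w.1.adicCompletion L)))) : GL (Fin 2) (w.1.adicCompletion L))) ∧
            (∀ W_M : ↥(unitaryGroupOfForm (galAdicCompletionMap (L := L) (IsCMField.complexConj L) hw) ((StdForm.antidiagonal 2).over (w.1.adicCompletion L))) → ℝ,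
              (∀ᵐ g ∂μ, ¬ (IsRegularElt (g.val : GL (Fin 2) (UnitaryGroup.LocalRing L v)) ∧
                  IsCompact ((Subgroup.centralizer ({g} : Set ((UnitaryGroup.cmDatum L 2 (Matrix.of fun i j : Fin 2 => if i.val + j.val + 1 = 2 then (1 : L) else 0)).Local v))) : Set ((UnitaryGroup.cmDatum L 2 (Matrix.of fun i j : Fin 2 => if i.val + j.val + 1 = 2 then (1 : L) else 0)).Local v))) →
                ∫ x' in ΩM (R g), ‖B u' (ρ (e.symm (x' * e g * x'⁻¹)) u)‖ ∂(μ.map e) ≤ W_M (e g)) → ∀ᵐ g ∂μ, ¬ (IsRegularElt (g.val : GL (Fin 2) (UnitaryGroup.LocalRing L v)) ∧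
                  IsCompact ((Subgroup.centralizer ({g} : Set ((UnitaryGroup.cmDatum L 2 (Matrix.of fun i j : Fin 2 => if i.val + j.val + 1 = 2 then (1 : L) else 0)).Local v))) : Set ((UnitaryGroup.cmDatum L 2 (Matrix.of fun i j : Fin 2 => if i.val + j.val + 1 = 2 then (1 : L) else 0)).Local v))) →
                ∫ x in Bset g, ‖B u' (ρ (x * g * x⁻¹) u)‖ ∂μ ≤ W_M (e g)) ∧
            (∀ W_M : ↥(unitaryGroupOfForm (galAdicCompletionMap (L := L) (IsCMField.complexConj L) hw) ((StdForm.antidiagonal 2).over (w.1.adicCompletion L))) → ℝ,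
              (∀ᵐ g ∂μ, (IsRegularElt (g.val : GL (Fin 2) (UnitaryGroup.LocalRing L v)) ∧
                  IsCompact ((Subgroup.centralizer ({g} : Set ((UnitaryGroup.cmDatum L 2 (Matrix.of fun i j : Fin 2 => if i.val + j.val + 1 = 2 then (1 : L) else 0)).Local v))) : Set ((UnitaryGroup.cmDatum L 2 (Matrix.of fun i j : Fin 2 => if i.val + j.val + 1 = 2 then (1 : L) else 0)).Local v))) →
                ∫ x', ‖B u' (ρ (e.symm (x' * e g * x'⁻¹)) u)‖ ∂(μ.map e) ≤ W_M (e g)) → ∀ᵐ g ∂μ, (IsRegularElt (g.val : GL (Fin 2) (UnitaryGroup.LocalRing L v)) ∧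
                  IsCompact ((Subgroup.centralizer ({g} : Set ((UnitaryGroup.cmDatum L 2 (Matrix.of fun i j : Fin 2 => if i.val + j.val + 1 = 2 then (1 : L) else 0)).Local v))) : Set ((UnitaryGroup.cmDatum L 2 (Matrix.of fun i j : Fin 2 => if i.val + j.val + 1 = 2 then (1 : L) else 0)).Local v))) →
                ∫ x, ‖B u' (ρ (x * g * x⁻¹) u)‖ ∂μ ≤ W_M (e g))) :
    ∀ (L : Type) [Field L] [NumberField L] [IsCMField L] (v : HeightOneSpectrum (𝓞 ↥(maximalRealSubfield L))),
      (∀ w : PlacesOver L v, IsCMField.complexConj L • w.1 = w.1) →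
    ∀ [MeasurableSpace ((UnitaryGroup.cmDatum L 2 (Matrix.of fun i j : Fin 2 => if i.val + j.val + 1 = 2 then (1 : L) else 0)).Local v)] [BorelSpace ((UnitaryGroup.cmDatum L 2 (Matrix.of fun i j : Fin 2 => if i.val + j.val + 1 = 2 then (1 : L) else 0)).Local v)]
      (μ : Measure ((UnitaryGroup.cmDatum L 2 (Matrix.of fun i j : Fin 2 => if i.val + j.val + 1 = 2 then (1 : L) else 0)).Local v)) [μ.IsHaarMeasure]
      (r : SmoothIrrep ((UnitaryGroup.cmDatum L 2 (Matrix.of fun i j : Fin 2 => if i.val + j.val + 1 = 2 then (1 : L) else 0)).Local v)), r.ρ.IsSupercuspidal →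
    ∀ (B : r.V →ₗ⋆[ℂ] r.V →ₗ[ℂ] ℂ), B.IsSymm → (∀ x : r.V, x ≠ 0 → 0 < (B x x).re) →
      (∀ (g : (UnitaryGroup.cmDatum L 2 (Matrix.of fun i j : Fin 2 => if i.val + j.val + 1 = 2 then (1 : L) else 0)).Local v) (x y : r.V), B (r.ρ g x) (r.ρ g y) = B x y) →
    ∀ (v₁ : r.V), v₁ ≠ 0 →
      ∃ (Ω : CompactExhaustion ((UnitaryGroup.cmDatum L 2 (Matrix.of fun i j : Fin 2 => if i.val + j.val + 1 = 2 then (1 : L) else 0)).Local v))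
        (F : (UnitaryGroup.cmDatum L 2 (Matrix.of fun i j : Fin 2 => if i.val + j.val + 1 = 2 then (1 : L) else 0)).Local v → ℂ) (M : (UnitaryGroup.cmDatum L 2 (Matrix.of fun i j : Fin 2 => if i.val + j.val + 1 = 2 then (1 : L) else 0)).Local v → ℝ),
        (∀ᵐ g ∂μ, ¬ (IsRegularElt (g.val : GL (Fin 2) (UnitaryGroup.LocalRing L v)) ∧
            IsCompact ((Subgroup.centralizer ({g} : Set ((UnitaryGroup.cmDatum L 2 (Matrix.of fun i j : Fin 2 => if i.val + j.val + 1 = 2 then (1 : L) else 0)).Local v))) : Set ((UnitaryGroup.cmDatum L 2 (Matrix.of fun i j : Fin 2 => if i.val + j.val + 1 = 2 then (1 : L) else 0)).Local v))) →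
          Tendsto (fun n => ∫ x in Ω n, B v₁ (r.ρ (x * g * x⁻¹) v₁) ∂μ) atTop (𝓝 (F g))) ∧
        (∀ n : ℕ, ∀ᵐ g ∂μ, ‖∫ x in Ω n, B v₁ (r.ρ (x * g * x⁻¹) v₁) ∂μ‖ ≤ M g) ∧
        LocallyIntegrable M μ :=
  K2E3SupercuspidalTruncatedCharAnalyticTwoOfLetters.sigSCanTwo_of_letters
    (fun K _ _ _ _ _ _ σ hσ hσv _ hϖ _ hJ a ha g =>
      K2E3FinConjCartanCoverTwo.exists_mem_doubleCoset_inv_pow σ hJ hσ hσv hϖ a ha g)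
    (fun K _ _ _ _ _ _ σ hσ hσv _ hϖ _ hJ a ha n M h hb =>
      K2E3FinConjCartanCoverTwo.v_upper_le_of_conj_inv_pow σ hJ hσ hσv hϖ a ha n M h hb)
    (fun K _ _ _ _ _ _ σ _ hσv _ _ _ hJ M n h3 h hall h01 i =>
      (WithZero.exp_le_exp.2 (by omega)).trans (K2E3FinConjCartanCoverTwo.exp_neg_le_v_apply_diag σ hJ hσv M n (by omega) h hall h01 i))
    (fun K _ _ _ _ _ _ σ => K2E3BoxCompactCentralizerCollisionTwo.exists_v_sub_lt_of_isCompact_centralizer K σ)  -- ★ p861203 predates the `[CharZero K]` ruling: drop the idle instance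
    K2E3TorusNearCollisionBoundTwo.measure_inter_nearCollision_le_two
    (K2E3SupercuspidalTruncatedCharAnalyticTwoOfEllWeight.sigSCanTwo_of_ellWeightPlace_two hLIM
      K2E3SupercuspidalTruncatedCharWeightKitShellTwo.exists_const_integral_heightBall_norm_conj_le_shell_place
      K2E3SupercuspidalTruncatedCharTokenLocIntLetterTwo.tokenLocInt_letter
      K2E3SupercuspidalTruncatedCharTorusDepthLettersTwo.torusOmega_letter
      K2E3SupercuspidalTruncatedCharTorusDepthLettersTwo.depth_letter)

end Summit.HodgeConjecture.HodgeConjecture.Cruxes.H413.K2E3SupercuspidalTruncatedCharAnalyticTwoOfLim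

end
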